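import Mathlib
import Summits.KontsevichZagierPeriods.Zeta5Search.Families.SeatingGapGrowth
import Summits.KontsevichZagierPeriods.Zeta5Search.Families.RayGrowthRealTransport
import HarnessLib

/-!
# ζ(5) search — Families: along EVERY live ray the gap constant terms grow like `1/M_τ(α,β)` (ray version of growth = reciprocal decay)

HONEST FRAMING: systematic search; no irrationality claim unless certified.  Cell `pub-zeta5`, certifier 2 (cert-2 g11,
2026-08-22).  Elementary real analysis of the coefficients of powers of a polynomial with non-negative integer
coefficients; nothing about the arithmetic of any zeta value; no conjecture node is used; no number of record moves.

`Families/SeatingGapGrowth` is the diagonal (all exponents `n`).  Here the exponents run along a RAY: natural exponents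
`β_i` on the finite edges of `τδ⁰` and `α_w` on the gaps (P2's ray data of `Families/RayGrowth`: `rayF τ α β =
∏_w gapN^{α_w} / ∏_{i finite} len_i^{β_i}`, `raySup τ α β = sup_{simplex} rayF`).  Put
`rayPoly τ β = ∏_{finite i} (Σ_{w ∈ span i} X_w)^{β_i}`, `rayBase α = (α_w)_w`, and
**`rayCT τ α β n = [X^{n·α}] (rayPoly τ β)^n`** (the gap constant terms of the ray; `= [X^{n·α}] rayPoly τ (n·β)`).
THEOREM (`tendsto_log_rayCT_div`): for a bijective seating `τ` and a LIVE ray (`rayCT τ α β 1 ≠ 0`, i.e. all Hall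
inequalities, `Families/SpanProductHall`):

  `log (rayCT τ α β n) / n ⟶ − log raySup τ α β`,

the reciprocal of the growth constant of Brown's generalised cellular integrals `I_τ(N·α, N·β)` along the ray
(`Families/RayGrowth.tendsto_integral_ray_root`, P2).  On the way: **liveness alone bounds Brown's ray function**,
`rayF τ α β ≤ 1` on the open simplex (`rayF_le_one_of_live`: the tilt is `1/rayF` and is `≥ [X^α] rayPoly ≥ 1`) — no
convergence hypothesis on the ray is needed for the supremum side.  Proof as in the diagonal file: cert-2 g9's
`CoeffAsymp.tendsto_log_coeff_pow_div` + the tilt dictionary `tilt(u) = 1 / rayF(t)` for the point `t` with gaps `∝ e^u`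
(degree-`0` homogeneity `Σ_{finite} β = Σ_w α` is forced by liveness).  Standard axioms only.
-/

noncomputable section

open Finset Real Filter Topology

namespace Summit.KontsevichZagierPeriods.Zeta5Search.Families.Cellular

namespace SeatingGap

variable {ℓ : ℕ} (τ : Fin (ℓ + 3) → Fin (ℓ + 3)) (α β : Fin (ℓ + 3) → ℕ)

/-! ## The ray polynomial, its base exponent and the ray constant terms -/

/-- Exponents of the ray polynomial: `β_i` on the finite edges of `τδ⁰`, `0` on the two edges through `∞`. -/
def rayExpN (i : Fin (ℓ + 3)) : ℕ := if (τ i).val ≠ ℓ + 2 ∧ (τ (i + 1)).val ≠ ℓ + 2 then β i else 0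

/-- **The ray polynomial** `∏_{finite edges i of τδ⁰} (Σ_{w ∈ span i} X_w)^{β_i}`. -/
def rayPoly : MvPolynomial (Fin (ℓ + 1)) ℤ := SpanHall.spanProd (edgeSpan τ) (rayExpN τ β)

/-- The base exponent vector `(α_w)_{w ≤ ℓ}` of the gaps (the finite `δ⁰`-edges). -/
def rayBase : Fin (ℓ + 1) →₀ ℕ := Finsupp.equivFunOnFinite.symm fun w => α ⟨w.val, by omega⟩

/-- **The ray gap constant terms** `rayCT τ α β n = [X^{n·α}] (rayPoly τ β)ⁿ`. -/
def rayCT (n : ℕ) : ℤ := MvPolynomial.coeff (n • rayBase α) (rayPoly τ β ^ n)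

/-- The coefficients of the ray polynomial are non-negative. -/
theorem coeff_rayPoly_pow_nonneg (n : ℕ) (m : Fin (ℓ + 1) →₀ ℕ) : 0 ≤ MvPolynomial.coeff m (rayPoly τ β ^ n) := by
  have h : rayPoly τ β ^ n = SpanHall.spanProd (edgeSpan τ) (fun i => rayExpN τ β i * n) := by
    unfold rayPoly SpanHall.spanProd
    rw [← Finset.prod_pow]
    exact Finset.prod_congr rfl fun i _ => by rw [← pow_mul]
  rw [h]
  exact SpanHall.coeff_spanProd_nonneg _ _ _

/-- `rayCT τ α β n ≥ 0`. -/
theorem rayCT_nonneg (n : ℕ) : 0 ≤ rayCT τ α β n := coeff_rayPoly_pow_nonneg τ β n _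

/-! ## Real coefficients, evaluation, tilt -/

/-- The ray polynomial with real coefficients. -/
def rayPolyR : MvPolynomial (Fin (ℓ + 1)) ℝ := MvPolynomial.map (Int.castRingHom ℝ) (rayPoly τ β)

/-- `rayCT = [X^{n·α}] Pⁿ` over `ℝ`. -/
theorem rayCT_eq_coeff_pow (n : ℕ) :
    (rayCT τ α β n : ℝ) = MvPolynomial.coeff (n • rayBase α) (rayPolyR τ β ^ n) := by
  rw [rayCT, rayPolyR, ← map_pow, MvPolynomial.coeff_map]
  simp

/-- Non-negative real coefficients. -/
theorem coeff_rayPolyR_nonneg (m : Fin (ℓ + 1) →₀ ℕ) : 0 ≤ MvPolynomial.coeff m (rayPolyR τ β) := by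
  rw [rayPolyR, MvPolynomial.coeff_map, eq_intCast]
  have := coeff_rayPoly_pow_nonneg τ β 1 m
  rw [pow_one] at this
  exact_mod_cast this

/-- `[X^α] P = rayCT τ α β 1`. -/
theorem coeff_base_rayPolyR : MvPolynomial.coeff (rayBase α) (rayPolyR τ β) = rayCT τ α β 1 := by
  have h := rayCT_eq_coeff_pow τ α β 1
  rw [pow_one, one_smul] at h
  exact h.symm

/-- **Evaluation**: `P(g) = ∏_i [finite i] (Σ_{w ∈ span i} g_w)^{β_i}`. -/
theorem eval_rayPolyR (g : Fin (ℓ + 1) → ℝ) : MvPolynomial.eval g (rayPolyR τ β) =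
    ∏ i : Fin (ℓ + 3), if (τ i).val ≠ ℓ + 2 ∧ (τ (i + 1)).val ≠ ℓ + 2 then (∑ w ∈ edgeSpan τ i, g w) ^ β i else 1 := by
  rw [rayPolyR, rayPoly, SpanHall.spanProd, map_prod, map_prod]
  refine Finset.prod_congr rfl fun i _ => ?_
  rw [map_pow, map_pow, SpanHall.spanPoly, map_sum, map_sum]
  simp only [MvPolynomial.map_X, MvPolynomial.eval_X, rayExpN]
  split_ifs <;> simp

/-- **Tilt dictionary**: `Σ_m [X^m]P · e^{(m − α)·u} = P(e^u) / ∏_w e^{α_w u_w}`. -/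
theorem ray_tilt_eq (u : Fin (ℓ + 1) → ℝ) :
    CoeffAsymp.tilt (rayPolyR τ β).support (fun m => MvPolynomial.coeff m (rayPolyR τ β)) (rayBase α) u =
      MvPolynomial.eval (fun i => exp (u i)) (rayPolyR τ β) / ∏ i, exp (u i) ^ (rayBase α i) := by
  have hdot : ∀ m : Fin (ℓ + 1) →₀ ℕ, exp (CoeffAsymp.dot (rayBase α) m u) =
      (∏ i, exp (u i) ^ (m i)) / ∏ i, exp (u i) ^ (rayBase α i) := by
    intro m
    have hs : CoeffAsymp.dot (rayBase α) m u = (∑ i, (m i : ℝ) * u i) - ∑ i, (rayBase α i : ℝ) * u i := by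
      simp only [CoeffAsymp.dot, CoeffAsymp.dvec, sub_mul, Finset.sum_sub_distrib]
    rw [hs, Real.exp_sub, Real.exp_sum, Real.exp_sum]
    congr 1
    · exact Finset.prod_congr rfl fun i _ => by rw [← Real.exp_nat_mul]
    · exact Finset.prod_congr rfl fun i _ => by rw [← Real.exp_nat_mul]
  unfold CoeffAsymp.tilt
  simp_rw [hdot, mul_div_assoc']
  rw [← Finset.sum_div, ← MvPolynomial.eval_eq']

/-! ## Brown's ray function in gap coordinates -/

/-- The denominator of `rayF` over the finite `τδ⁰`-edges:
`den τ β t = ∏_i [finite i] (Σ_{w ∈ span i} gapN t w)^{β_i}`. -/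
theorem den_eq_prod_span (hτi : Function.Injective τ) (t : Fin ℓ → ℝ) :
    den τ (fun i => (β i : ℤ)) t =
      ∏ i : Fin (ℓ + 3), if (τ i).val ≠ ℓ + 2 ∧ (τ (i + 1)).val ≠ ℓ + 2 then (∑ w ∈ edgeSpan τ i, gapN t w) ^ β i else 1 := by
  unfold den
  refine Finset.prod_congr rfl fun i _ => ?_
  rw [zpow_natCast]
  split_ifs with h
  · have hlen : ef t (τ i) (τ (i + 1)) = (cellEdges τ hτi).len t (Sum.inr ⟨i, h⟩) := by
      rw [ef_sigma_of_finite τ t i h]; rfl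
    rw [hlen, EdgeFamily.len_eq_sum_gap, ← edgeSpan_eq_span τ hτi ⟨i, h⟩]
  · rw [ef_sigma_of_infinite τ t i h, one_pow]

/-- The ray quotient `Λ(g) = P(g) / g^α` of a free gap vector. -/
def rayLam (g : Fin (ℓ + 1) → ℝ) : ℝ :=
  MvPolynomial.eval g (rayPolyR τ β) / ∏ w, g w ^ (rayBase α w)

/-- **`Λ(gaps of t) = 1 / rayF(t)`** on the open simplex. -/
theorem rayLam_gapN (hτi : Function.Injective τ) (t : Fin ℓ → ℝ) :
    rayLam τ α β (fun w => gapN t w) = (rayF τ (fun i => (α i : ℤ)) (fun i => (β i : ℤ)) t)⁻¹ := by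
  rw [rayF, inv_div, rayLam, eval_rayPolyR, den_eq_prod_span τ β hτi, num_eq_prod_gapN_zpow]
  congr 1

/-- Liveness forces degree-`0` homogeneity: `Σ_w α_w = Σ_{finite i} β_i`. -/
theorem sum_rayBase_eq_of_live (h1 : rayCT τ α β 1 ≠ 0) : ∑ w, rayBase α w = ∑ i, rayExpN τ β i := by
  have hhom : (rayPoly τ β).IsHomogeneous (∑ i, rayExpN τ β i) := by
    unfold rayPoly SpanHall.spanProd
    refine MvPolynomial.IsHomogeneous.prod _ _ _ fun i _ => ?_
    have hX : (SpanHall.spanPoly (edgeSpan τ) i).IsHomogeneous 1 :=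
      MvPolynomial.IsHomogeneous.sum _ _ _ fun w _ => MvPolynomial.isHomogeneous_X ℤ w
    simpa using hX.pow (rayExpN τ β i)
  by_contra hne
  apply h1
  unfold rayCT
  rw [pow_one, one_smul]
  apply hhom.coeff_eq_zero
  rw [Finsupp.degree_eq_sum]
  exact hne

/-- **Homogeneity of degree `0`** of `Λ` on positive vectors (for a live ray): `Λ(c·g) = Λ(g)`. -/
theorem rayLam_smul (h1 : rayCT τ α β 1 ≠ 0) {c : ℝ} (hc : 0 < c) (g : Fin (ℓ + 1) → ℝ) :
    rayLam τ α β (fun w => c * g w) = rayLam τ α β g := by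
  have hdeg := sum_rayBase_eq_of_live τ α β h1
  unfold rayLam
  rw [eval_rayPolyR, eval_rayPolyR]
  have hnum : (∏ i : Fin (ℓ + 3), if (τ i).val ≠ ℓ + 2 ∧ (τ (i + 1)).val ≠ ℓ + 2 then
        (∑ w ∈ edgeSpan τ i, c * g w) ^ β i else 1) =
      c ^ (∑ i, rayExpN τ β i) * ∏ i : Fin (ℓ + 3), if (τ i).val ≠ ℓ + 2 ∧ (τ (i + 1)).val ≠ ℓ + 2 then
        (∑ w ∈ edgeSpan τ i, g w) ^ β i else 1 := by
    rw [← Finset.prod_pow_eq_pow_sum, ← Finset.prod_mul_distrib]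
    refine Finset.prod_congr rfl fun i _ => ?_
    simp only [rayExpN]
    split_ifs
    · rw [← Finset.mul_sum, mul_pow]
    · simp
  have hden : ∏ w, (c * g w) ^ (rayBase α w) = c ^ (∑ w, rayBase α w) * ∏ w, g w ^ (rayBase α w) := by
    rw [← Finset.prod_pow_eq_pow_sum, ← Finset.prod_mul_distrib]
    exact Finset.prod_congr rfl fun w _ => by rw [mul_pow]
  rw [hnum, hden, hdeg, mul_div_mul_left _ _ (pow_ne_zero _ hc.ne')]

/-- The tilt at `u` is `Λ(e^u)`. -/
theorem ray_tilt_eq_rayLam (u : Fin (ℓ + 1) → ℝ) :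
    CoeffAsymp.tilt (rayPolyR τ β).support (fun m => MvPolynomial.coeff m (rayPolyR τ β)) (rayBase α) u =
      rayLam τ α β (fun i => exp (u i)) := by
  rw [ray_tilt_eq]; rfl

/-- The tilt is at least `[X^α] P = rayCT τ α β 1`. -/
theorem rayCT_one_le_tilt (u : Fin (ℓ + 1) → ℝ) :
    (rayCT τ α β 1 : ℝ) ≤
      CoeffAsymp.tilt (rayPolyR τ β).support (fun m => MvPolynomial.coeff m (rayPolyR τ β)) (rayBase α) u := by
  by_cases h0 : rayCT τ α β 1 = 0
  · rw [h0, Int.cast_zero]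
    exact Finset.sum_nonneg fun m _ => mul_nonneg (coeff_rayPolyR_nonneg τ β m) (Real.exp_pos _).le
  · have hc : ∀ m ∈ (rayPolyR τ β).support, 0 < MvPolynomial.coeff m (rayPolyR τ β) := fun m hm =>
      lt_of_le_of_ne (coeff_rayPolyR_nonneg τ β m) (Ne.symm (MvPolynomial.mem_support_iff.1 hm))
    have hB : rayBase α ∈ (rayPolyR τ β).support :=
      MvPolynomial.mem_support_iff.2 (by rw [coeff_base_rayPolyR]; exact_mod_cast h0)
    have := CoeffAsymp.term_le_tilt hc (rayBase α) u hB
    rw [coeff_base_rayPolyR] at this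
    have hdot : CoeffAsymp.dot (rayBase α) (rayBase α) u = 0 := by simp [CoeffAsymp.dot, CoeffAsymp.dvec]
    rwa [hdot, Real.exp_zero, mul_one] at this

/-! ## Liveness bounds Brown's ray function; the infimum of the tilt -/

/-- **Liveness bounds the ray function**: if `rayCT τ α β 1 ≠ 0` then `rayF τ α β ≤ 1` on the open simplex (indeed
`≤ 1/rayCT τ α β 1`). -/
theorem rayF_le_one_of_live (hτi : Function.Injective τ) (h1 : rayCT τ α β 1 ≠ 0) {t : Fin ℓ → ℝ}
    (ht : t ∈ openSimplex ℓ) : rayF τ (fun i => (α i : ℤ)) (fun i => (β i : ℤ)) t ≤ 1 := by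
  have hpos := rayF_pos τ (fun i => (α i : ℤ)) (fun i => (β i : ℤ)) hτi ht
  have hg : ∀ w : Fin (ℓ + 1), 0 < gapN t w := (mem_openSimplex_iff_gapN t).1 ht
  have htilt := rayCT_one_le_tilt τ α β (fun w => Real.log (gapN t w))
  rw [ray_tilt_eq_rayLam] at htilt
  have hexp : (fun w : Fin (ℓ + 1) => exp (Real.log (gapN t w))) = fun w : Fin (ℓ + 1) => gapN t w :=
    funext fun w => Real.exp_log (hg w)
  rw [hexp, rayLam_gapN τ α β hτi] at htilt
  have hc1 : (1 : ℝ) ≤ rayCT τ α β 1 := by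
    have := rayCT_nonneg τ α β 1
    exact_mod_cast (lt_of_le_of_ne this (Ne.symm h1))
  have : (1 : ℝ) ≤ (rayF τ (fun i => (α i : ℤ)) (fun i => (β i : ℤ)) t)⁻¹ := hc1.trans htilt
  rwa [one_le_inv₀ hpos] at this

/-- Liveness makes the values of the ray function bounded above. -/
theorem bddAbove_rayF_of_live (hτi : Function.Injective τ) (h1 : rayCT τ α β 1 ≠ 0) :
    BddAbove (rayF τ (fun i => (α i : ℤ)) (fun i => (β i : ℤ)) '' openSimplex ℓ) :=
  ⟨1, by rintro _ ⟨t, ht, rfl⟩; exact rayF_le_one_of_live τ α β hτi h1 ht⟩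

/-- **`⨅_u tilt(u) = 1 / raySup τ α β`** for a live ray of an injective seating. -/
theorem iInf_ray_tilt_eq_inv_raySup (hτi : Function.Injective τ) (h1 : rayCT τ α β 1 ≠ 0) :
    (⨅ u : Fin (ℓ + 1) → ℝ,
      CoeffAsymp.tilt (rayPolyR τ β).support (fun m => MvPolynomial.coeff m (rayPolyR τ β)) (rayBase α) u) =
      (raySup τ (fun i => (α i : ℤ)) (fun i => (β i : ℤ)))⁻¹ := by
  set F := rayF τ (fun i => (α i : ℤ)) (fun i => (β i : ℤ)) with hF
  set T : (Fin (ℓ + 1) → ℝ) → ℝ := fun u =>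
    CoeffAsymp.tilt (rayPolyR τ β).support (fun m => MvPolynomial.coeff m (rayPolyR τ β)) (rayBase α) u with hT
  have hbdd := bddAbove_rayF_of_live τ α β hτi h1
  have hne : (F '' openSimplex ℓ).Nonempty := (openSimplex_nonempty ℓ).image _
  obtain ⟨t₀, ht₀⟩ := openSimplex_nonempty ℓ
  have hMpos : 0 < raySup τ (fun i => (α i : ℤ)) (fun i => (β i : ℤ)) :=
    (rayF_pos τ _ _ hτi ht₀).trans_le (le_csSup hbdd ⟨t₀, ht₀, rfl⟩)
  -- the tilt at `log (gaps of t)` is `1 / F(t)`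
  have hTt : ∀ t ∈ openSimplex ℓ, T (fun w => Real.log (gapN t w)) = (F t)⁻¹ := by
    intro t ht
    have hg : ∀ w : Fin (ℓ + 1), 0 < gapN t w := (mem_openSimplex_iff_gapN t).1 ht
    simp only [hT]
    rw [ray_tilt_eq_rayLam]
    have hexp : (fun w : Fin (ℓ + 1) => exp (Real.log (gapN t w))) = fun w : Fin (ℓ + 1) => gapN t w :=
      funext fun w => Real.exp_log (hg w)
    rw [hexp, rayLam_gapN τ α β hτi]
  -- the tilt at any `u` is `1 / F(t)` for the point `t` with gaps `∝ e^u`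
  have hTu : ∀ u, ∃ t ∈ openSimplex ℓ, T u = (F t)⁻¹ := by
    intro u
    have hg : ∀ w : Fin (ℓ + 1), 0 < exp (u w) := fun w => Real.exp_pos _
    obtain ⟨t, ht, htg⟩ := exists_gapN_eq_div hg
    have hS : 0 < ∑ w', exp (u w') := Finset.sum_pos (fun w _ => hg w) Finset.univ_nonempty
    refine ⟨t, ht, ?_⟩
    simp only [hT]
    rw [ray_tilt_eq_rayLam, ← rayLam_gapN τ α β hτi]
    have : (fun w : Fin (ℓ + 1) => gapN t w) = fun w : Fin (ℓ + 1) => (∑ w', exp (u w'))⁻¹ * exp (u w) := by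
      funext w; rw [htg, div_eq_inv_mul]
    rw [this, rayLam_smul τ α β h1 (inv_pos.2 hS)]
  have hTbdd : BddBelow (Set.range T) := ⟨0, by
    rintro _ ⟨u, rfl⟩
    exact Finset.sum_nonneg fun m _ => mul_nonneg (coeff_rayPolyR_nonneg τ β m) (Real.exp_pos _).le⟩
  apply le_antisymm
  · -- `⨅ T ≤ 1/M`: else `c = 1/⨅T < M`, some `F(t) > c`, and `T(log gaps t) = 1/F(t) < ⨅ T`
    have hIpos : 0 < ⨅ u, T u := by
      have hc1 : (1 : ℝ) ≤ rayCT τ α β 1 := by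
        have := rayCT_nonneg τ α β 1
        exact_mod_cast (lt_of_le_of_ne this (Ne.symm h1))
      exact lt_of_lt_of_le (by linarith) (le_ciInf fun u => hc1.trans (rayCT_one_le_tilt τ α β u))
    by_contra hlt
    push Not at hlt
    have hcM : (⨅ u, T u)⁻¹ < raySup τ (fun i => (α i : ℤ)) (fun i => (β i : ℤ)) := by
      have := inv_strictAnti₀ (inv_pos.2 hMpos) hlt
      rwa [inv_inv] at this
    obtain ⟨_, ⟨t, ht, rfl⟩, hct⟩ := exists_lt_of_lt_csSup hne hcM
    have h2 : T (fun w => Real.log (gapN t w)) < ⨅ u, T u := by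
      rw [hTt t ht]
      have := inv_strictAnti₀ (inv_pos.2 hIpos) hct
      rwa [inv_inv] at this
    exact absurd (lt_of_le_of_lt (ciInf_le hTbdd _) h2) (lt_irrefl _)
  · refine le_ciInf fun u => ?_
    obtain ⟨t, ht, hu⟩ := hTu u
    rw [hu]
    exact inv_anti₀ (rayF_pos τ _ _ hτi ht) (le_csSup hbdd ⟨t, ht, rfl⟩)

/-! ## The theorem -/

/-- **Ray growth = reciprocal ray decay.**  For an injective seating `τ` and a live ray (`rayCT τ α β 1 ≠ 0`):
`log (rayCT τ α β n) / n → −log raySup τ α β`. -/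
theorem tendsto_log_rayCT_div (hτi : Function.Injective τ) (h1 : rayCT τ α β 1 ≠ 0) :
    Tendsto (fun n : ℕ => Real.log (rayCT τ α β n : ℝ) / n) atTop
      (𝓝 (-Real.log (raySup τ (fun i => (α i : ℤ)) (fun i => (β i : ℤ))))) := by
  have h := CoeffAsymp.tendsto_log_coeff_pow_div (rayPolyR τ β) (coeff_rayPolyR_nonneg τ β) (B := rayBase α)
    (by rw [coeff_base_rayPolyR]; exact_mod_cast h1)
  rw [iInf_ray_tilt_eq_inv_raySup τ α β hτi h1, Real.log_inv] at h
  refine Tendsto.congr (fun n => ?_) h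
  rw [rayCT_eq_coeff_pow]

end SeatingGap

end Summit.KontsevichZagierPeriods.Zeta5Search.Families.Cellular
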